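import Summits.BirchSwinnertonDyer.BirchSwinnertonDyer.Theorems.ErratumRoadFiveNonSurjCornerFiveJLine
import Summits.BirchSwinnertonDyer.BirchSwinnertonDyer.Theorems.ErratumRoadFiveNonSurjCornerBinders
import HarnessLib

/-!
# Route `ErratumRoadFive` (rung K2), crux `NonSurjCorner` (item stmt-BirchSwinnertonDyer-19065):
# THE CRUX RE-INDEXED BY THE RATIONAL POINTS OF TWO CURVES — `NonSurjCorner` BY NAME is equivalent to
# «the `p`-part at 5 for every X11b curve on Zywina's `J₉`-line» ∧ «the `p`-part at 7 for every X11b curve on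
# Zywina's `N_s(7)`-line», modulo Zywina's Thms. 1.4 ∕ 1.5 by name (cell `bsd-stepL`, seat
# `bsd-stepL-corner5-p2` g5, WIDTH-LEVER lane B; `--supports stmt-BirchSwinnertonDyer-19065 --as helper`)

WHY THIS FILE. This lane's structure theorems put every corner pair on one of two rational curves
(`…NonSurjCornerFiveJLine` §4: `p = 5 ∧ j ∈ J₉(ℚ)` or `p = 7 ∧ j ∈ J₂⁽⁷⁾(ℚ)`), and g3's `…NonSurjCornerBinders`
showed the binders `p ∣ ord_p Δ_min`, `¬Ram` idle. Here the two are combined into ONE kernel-certified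
RE-INDEXING of the crux, so that a planner may re-cut `stub_corner5` ∕ `stub_corner7` by the parameter
`t ∈ ℙ¹(ℚ)` without changing the content:

* `nonSurjCorner_of_lines` — IF the `p`-part `Typed.MissingPPartAt W 5` holds for every globally minimal
  X11b curve `W` at `5` with `j(W) = t³(t²+5t+40)` (`t ∈ ℚ`) AND `Typed.MissingPPartAt W 7` holds for every
  X11b curve at `7` with `j(W)·(t³−4t²+3t+1)⁷ = t(t+1)³(t²−5t+1)³(t²−5t+8)³(t⁴−5t³+8t²−7t+7)³`, THEN the crux
  `NonSurjCorner` holds — given Zywina's two «only if» halves by name (`hZ5`, `hZ7`: they produce the `t`).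
* `lines_of_nonSurjCorner` — conversely the crux implies both line statements, given the «if» halves:
  at `5` this is a THEOREM of the tree (`zywina2015_thm14_not_surjective_five_of_j_eq_J9_holds`), at `7`
  the fact `hZ7'` (`zywina2015_thm15_not_surjective_seven_of_j_eq_J2`); the two idle binders are
  supplied by g3's `NonSurjCorner.dvd_padicValInt_minimalDiscriminantInt` ∕ `NonSurjCorner.not_ram`.
* **`nonSurjCorner_iff_lines`** — `NonSurjCorner ↔ LINE₅ ∧ LINE₇` modulo the three Zywina facts.

HONEST FRAMING: bookkeeping over landed theorems and THREE cite-tagged named facts (two «only if» halves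
+ the `ℓ = 7` «if» half of Zywina's Thms. 1.4/1.5; the `ℓ = 5` «if» half is proved in the tree); nothing
here proves the crux, a registered stub or BSD for any class; no census number moves (T7).
References: [Zywina2015] §1.3–1.4, Thms. 1.4, 1.5 (arXiv:1508.07660 pp. 4–6); [Serre1972] §2.4 Prop. 15.
-/

set_option linter.dupNamespace false -- `Summit.BirchSwinnertonDyer.BirchSwinnertonDyer` (summit = problem), tree-wide

noncomputable section

open scoped Classical

namespace Summit.BirchSwinnertonDyer.BirchSwinnertonDyer.Theorems.CornerShape

open WeierstrassCurve
  Literature.NumberTheory.EllipticCurves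
  Literature.NumberTheory.EllipticCurves.Rank1Residual
  Summit.BirchSwinnertonDyer.Rank1Residual
  Summit.BirchSwinnertonDyer.BirchSwinnertonDyer.Theorems.CornerLocal

/-- **The two line statements imply the crux** (given Zywina's «only if» halves `hZ5`, `hZ7` by name).
[cite: Zywina2015, Thm. 1.4 (i = 9), Thm. 1.5 (i = 2) (arXiv:1508.07660 pp. 4–6)] -/
theorem nonSurjCorner_of_lines (hZ5 : zywina2015_thm14_exists_j_eq_J9_of_zywinaG9_five)
    (hZ7 : zywina2015_thm15_exists_j_eq_J2_of_splitCartanNormalizer_seven)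
    (h5 : ∀ (W : WeierstrassCurve ℚ) [W.IsElliptic] [W.IsGloballyMinimal] (p : ℕ) [Fact p.Prime] (t : ℚ),
      p = 5 → W.j = t ^ 3 * (t ^ 2 + 5 * t + 40) → ClassX11b W p → Typed.MissingPPartAt W p)
    (h7 : ∀ (W : WeierstrassCurve ℚ) [W.IsElliptic] [W.IsGloballyMinimal] (p : ℕ) [Fact p.Prime] (t : ℚ),
      p = 7 → t ^ 3 - 4 * t ^ 2 + 3 * t + 1 ≠ 0 →
      W.j * (t ^ 3 - 4 * t ^ 2 + 3 * t + 1) ^ 7 =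
        t * (t + 1) ^ 3 * (t ^ 2 - 5 * t + 1) ^ 3 * (t ^ 2 - 5 * t + 8) ^ 3 *
          (t ^ 4 - 5 * t ^ 3 + 8 * t ^ 2 - 7 * t + 7) ^ 3 →
      ClassX11b W p → Typed.MissingPPartAt W p) :
    Theses.ErratumRoadFive.NonSurjCorner := by
  rw [nonSurjCorner_iff_threeBinders]
  intro W _ _ p _ hX hns hp
  rcases hp with rfl | rfl
  · obtain ⟨t, hj⟩ := NonSurjCorner.exists_j_eq_J9_five W hZ5 hX hns
    exact h5 W 5 t rfl hj hX
  · obtain ⟨t, ht, hj⟩ := NonSurjCorner.exists_j_eq_J2_seven W hZ7 hX hns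
    exact h7 W 7 t rfl ht hj hX

/-- **The crux implies the two line statements** (given the `ℓ = 7` «if» half `hZ7'` by name; at `5` the
«if» half is the tree's theorem `zywina2015_thm14_not_surjective_five_of_j_eq_J9_holds`; CM is excluded on
class X11b by the multiplicative prime; the idle binders come from g3's `…NonSurjCornerBinders`).
[cite: Zywina2015, Thm. 1.4 (i = 9), Thm. 1.5 (i = 2)] [cite: Serre1972, §2.4 Prop. 15] -/
theorem lines_of_nonSurjCorner (hZ7' : zywina2015_thm15_not_surjective_seven_of_j_eq_J2)
    (h : Theses.ErratumRoadFive.NonSurjCorner) :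
    (∀ (W : WeierstrassCurve ℚ) [W.IsElliptic] [W.IsGloballyMinimal] (p : ℕ) [Fact p.Prime] (t : ℚ),
      p = 5 → W.j = t ^ 3 * (t ^ 2 + 5 * t + 40) → ClassX11b W p → Typed.MissingPPartAt W p) ∧
    (∀ (W : WeierstrassCurve ℚ) [W.IsElliptic] [W.IsGloballyMinimal] (p : ℕ) [Fact p.Prime] (t : ℚ),
      p = 7 → t ^ 3 - 4 * t ^ 2 + 3 * t + 1 ≠ 0 →
      W.j * (t ^ 3 - 4 * t ^ 2 + 3 * t + 1) ^ 7 =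
        t * (t + 1) ^ 3 * (t ^ 2 - 5 * t + 1) ^ 3 * (t ^ 2 - 5 * t + 8) ^ 3 *
          (t ^ 4 - 5 * t ^ 3 + 8 * t ^ 2 - 7 * t + 7) ^ 3 →
      ClassX11b W p → Typed.MissingPPartAt W p) := by
  rw [nonSurjCorner_iff_threeBinders] at h
  refine ⟨fun W _ _ p _ t hp hj hX ↦ ?_, fun W _ _ p _ t hp ht hj hX ↦ ?_⟩
  · subst hp
    have hns : ¬ Surj W 5 :=
      zywina2015_thm14_not_surjective_five_of_j_eq_J9_holds W (NonSurjCorner.not_hasCM W 5 hX) t hj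
    exact h W 5 hX hns (Or.inl rfl)
  · subst hp
    have hns : ¬ Surj W 7 := hZ7' W (NonSurjCorner.not_hasCM W 7 hX) t ht hj
    exact h W 7 hX hns (Or.inr rfl)

/-- **THE CRUX RE-INDEXED BY `X_{G₉}(ℚ) ⊔ X_{N_s(7)}(ℚ)`**: `NonSurjCorner` BY NAME is EQUIVALENT to the
conjunction of the two line statements — «`Typed.MissingPPartAt W 5` for every globally minimal X11b curve
at `5` with `j(W) = t³(t²+5t+40)`, `t ∈ ℚ`» and «`Typed.MissingPPartAt W 7` for every X11b curve at `7` with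
`j(W) = J₂(t)`, `t ∈ ℚ`» — modulo Zywina 2015 Thm. 1.4 (`i = 9`, ⟹) and Thm. 1.5 (`i = 2`, both halves)
by name. A re-cut of `stub_corner5` ∕ `stub_corner7` by the parameter `t` is therefore content-preserving.
[cite: Zywina2015, Thm. 1.4 (i = 9), Thm. 1.5 (i = 2) (arXiv:1508.07660 pp. 4–6)] [cite: Serre1972, §2.4 Prop. 15] -/
theorem nonSurjCorner_iff_lines (hZ5 : zywina2015_thm14_exists_j_eq_J9_of_zywinaG9_five)
    (hZ7 : zywina2015_thm15_exists_j_eq_J2_of_splitCartanNormalizer_seven)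
    (hZ7' : zywina2015_thm15_not_surjective_seven_of_j_eq_J2) :
    Theses.ErratumRoadFive.NonSurjCorner ↔
      (∀ (W : WeierstrassCurve ℚ) [W.IsElliptic] [W.IsGloballyMinimal] (p : ℕ) [Fact p.Prime] (t : ℚ),
        p = 5 → W.j = t ^ 3 * (t ^ 2 + 5 * t + 40) → ClassX11b W p → Typed.MissingPPartAt W p) ∧
      (∀ (W : WeierstrassCurve ℚ) [W.IsElliptic] [W.IsGloballyMinimal] (p : ℕ) [Fact p.Prime] (t : ℚ),
        p = 7 → t ^ 3 - 4 * t ^ 2 + 3 * t + 1 ≠ 0 →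
        W.j * (t ^ 3 - 4 * t ^ 2 + 3 * t + 1) ^ 7 =
          t * (t + 1) ^ 3 * (t ^ 2 - 5 * t + 1) ^ 3 * (t ^ 2 - 5 * t + 8) ^ 3 *
            (t ^ 4 - 5 * t ^ 3 + 8 * t ^ 2 - 7 * t + 7) ^ 3 →
        ClassX11b W p → Typed.MissingPPartAt W p) :=
  ⟨lines_of_nonSurjCorner hZ7', fun h => nonSurjCorner_of_lines hZ5 hZ7 h.1 h.2⟩

end Summit.BirchSwinnertonDyer.BirchSwinnertonDyer.Theorems.CornerShape

end
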